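import Summits.CriticalPhenomena.Ising3DConformalLimit.Theses.IsingEuclidUpgrade
import Summits.CriticalPhenomena.Ising3DConformalLimit.Theses.PrecisionLaplacian
import Summits.CriticalPhenomena.Ising3DConformalLimit.Theorems.IsingEuclidUpgradeR2RotInvPowerLaw.Negative.LaplaceGaugeSeparation
import Literature.Probability.LatticeModels.CriticalTwoPointBounds
import HarnessLib

/-!
# Disproof of `IsingEuclidUpgradeR2RotInvPowerLaw` (stmt-CriticalPhenomena-0634) — findings

Standing crux disprover `refuter-cdisprove-stmt-CriticalPhenomena-0634-0`, cycle 1 (2026-08-17). Crux (r2 of route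
`IsingEuclidUpgrade`, rank-7 crux of `PrecisionLaplacian`, shared by 4 more routes):
`∃ Δ c > 0, ⟨σ₀σ_x⟩_{β_c(3)} · |x|₂^{2Δ} → c` cofinitely on `ℤ³` (`G := criticalTwoPoint 3`). Line picked by the
lead: `Lines/tower_profile_rigidity.lean` (T1 `stub_dyadicTowerLaw`, S2 `stub_integerDilationLaw`, A
`stub_angularProfile`, R `stub_rigidityTransfer`; variant Q: T1, Sray `stub_rayDilationLaw`, Rray — LANDED p165602).
This file is `lean check`ed: rc 0, NO `sorry`. Everything below is kernel-checked.

## Findings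

* F0 VERDICT — NO KILL, and none is to be expected: the crux is the rotation-restoration-plus-pure-power-law
  conjecture for the critical 3-D Ising two-point function, believed TRUE (RG: the leading cubic-anisotropy
  operator (spin 4) of the 3-D Ising fixed point has dimension ≈ 5.02 > 3, so lattice anisotropy of the amplitude
  dies like `|x|^{-2.02}`; corrections to scaling are powers `|x|^{-ω}`, `ω ≈ 0.83`, no logarithms in `d = 3`;
  Duminil-Copin ICM 2022 §8.1 lists it as open). The statement is junk-free (F1). What a disprover CAN do is
  certify which parts of the line are NOT consequences of the model-blind toolkit — F2–F4 — i.e. where the Ising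
  hypothesis must enter.
* F1 HYGIENE. `crux_iff : crux ↔ PowerLawOf (criticalTwoPoint 3)` (`Iff.rfl`, both route decls). The `x = 0` term
  (`√0 ^ (2Δ) = 0` for `Δ ≠ 0`) is swallowed by `cofinite`; `c > 0` with the envelope forces `2Δ ∈ [1, 2]`
  (doubling argument as in `not_powerLaw_*` below + `criticalTwoPoint_bounds_holds`); `EnvelopeOf (criticalTwoPoint 3)`
  is the tree theorem (`envelope_criticalTwoPoint`). Model-blind implications valid for EVERY `G`:
  crux ⇒ D1 (`axisPowerLaw_of_powerLaw`) ⇒ T1 (`dyadicTowerLaw_of_axisPowerLaw`).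
* F2 (W2, §2) **S2 / Sray are load-bearing and carry the "complex-dimension" content.** The log₂-PERIODIC gauge
  `G x = h ⌊|x|₂⌋`, `h n = (2 + cos(2π log₂ n))/n`: positive, cubic symmetric, in the envelope, T1 EXACT
  (`G(2^j e₀)2^j = 3`), S3 and A (`Ψ ≡ 1`) IDENTICAL — yet S2 fails at `k = 3` for EVERY `Δ`
  (`not_integerDilationLaw_GLP`) and the crux fails (`not_powerLaw_GLP`). Assembled:
  `integerDilationLaw_not_of_tower_isotropy_envelope`, `powerLaw_not_of_tower_isotropy_envelope`.
  So {T1, S3, A, envelope, symmetry} ⊬ S2: a proof of S2 must exclude a `log 2`-commensurable log-periodic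
  modulation (= a complex scaling dimension `Δ ± iπ/log 2`) by Ising-specific means. NOTE for variant P/Q: S2's
  `k = 2^i` cases are consistent with W2; the first informative case is `k = 3` (idea `two-dilations-suffice`).
* F3 (W1, §3) **T1 is load-bearing and carries the "no drift" (purity) content.** The DRIFTING gauge
  `h n = 1/(n(1 + log n))`: positive, symmetric, in the envelope, S2 at `Δ = 1/2` for EVERY `k`
  (`integerDilationLaw_GDR`), S3 and A identical — yet T1 fails (`not_dyadicTowerLaw_GDR`, ratio trick: consecutive
  tower terms force `2Δ = 1`, then the terms `1/(1 + j log 2) → 0`), hence D1 and the crux fail. Assembled: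
  `dyadicTowerLaw_not_of_dilation_isotropy_envelope`, `powerLaw_not_of_dilation_isotropy_envelope`.
  So {S2, S3, A, envelope, symmetry} ⊬ T1.
* F4 (W3, §4) **Reflection positivity is load-bearing in R / Rray.** The QUARTIC kernel `(Σxᵢ⁴)/(Σxᵢ²)³`
  (the HRP2 disprover's `hrp2Rigidity_false_without_RP` witness, transported): positive, hyperoctahedrally
  symmetric, in the envelope, EXACTLY homogeneous of degree `-2` along every lattice ray — so T1 (`Δ = 1`) and the
  ray dilation law Sray (`Δ = 1`, every ray, every `k`) hold with constant sequences — yet S3 fails (diagonal/axis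
  ratio `→ 1/3`, `not_ratioIsotropy_GQ`) and the crux fails (`not_powerLaw_GQ`). Assembled:
  `ratioIsotropy_not_of_tower_rayDilation_envelope`, `powerLaw_not_of_tower_rayDilation_envelope`.
  So the MODEL-BLIND forms of `stub_rigidityTransfer` / `stub_rayRigidityTransfer` are false; the landed Rray
  (`pairLimit_of_rayRV` → `HRP2Rigidity_of`) uses nine-mirror RP of `criticalTwoPoint 3` essentially, as it must.
* F5 JOINT SUFFICIENCY of the skeleton: `IsingEuclidUpgradeR2RotInvPowerLaw_of : T1 → S2 → A → R → r2` and
  `…_of_ray : T1 → Sray → Rray → r2` are kernel-checked in `Lines/tower_profile_rigidity.lean`; the two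
  independent `∃ Δ` of T1 and S2 are reconciled inside (`axisPowerLaw_of_tower`, via `2Δ₁ = 2Δ₂` from `k = 2`);
  no smuggled gap. The registered stub texts are junk-free (divisions by `G(⌊|x|₂⌋e₀) > 0`; `⌊·⌋₊`, `x = 0`
  swallowed by `cofinite`; in A/R the profile `Ψ` is only ever evaluated at rational directions, its continuity
  clause is what ties them — harmless).
* F6 STUB-BY-STUB (what can still go wrong for the TRUE `G`, given F2–F4): T1 can fail only by a DRIFT along the
  single tower `2^j` (W1-type: `η` undefined or a slowly varying factor); S2/Sray only by a non-regularly-varying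
  axis function (W2-type log-periodicity being the tower-invisible case); A only if the angular profile does not
  settle; R, Rray, U are theorems. None of T1/S2/Sray/A is refutable here: each is implied by the crux, which is
  expected true. No `stub_*_false` target exists; `-- Targets`: none (payload `stuck_stubs = []`).
* F2′ (W4, §6; LANDED p168166 + p168308) **Even the full AXIS toolkit — including reflection positivity and
  complete monotonicity — does not see S2.** T1 and S2 are statements about the axis sequence
  `g(n) = ⟨σ₀σ_{ne₀}⟩` alone; the tree knows of it: positivity, `g(n+1) ≤ g(n)` (MMS /
  `criticalTwoPoint_axis_succ_le`), log-convexity `g(n)² ≤ g(n−1)g(n+1)` (`criticalTwoPoint_axis_sq_le`, used by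
  transfer U), the envelope, and half-line positive-definiteness `Σ c_a c_b g(p_a+p_b) ≥ 0` (RP in the mirror
  `x₀ = 0`, `CriticalCorrNineMirrorRP_holds`). Witness W4: `g n = h(max n ½)`, `h r = ∫₀^∞ e^{-rt}(1 + ½Re ζt^{iτ})dt`,
  `τ = 2π/log 2`, `ζ = z̄/‖z‖`, `z = Γ(1+iτ)(1 − 3^{-iτ})`: a Laplace transform of a POSITIVE log₂-periodic density,
  hence completely monotone and half-line RP, with EXACT `h(2r) = h(r)/2` (so T1 exact, `k = 2^i` dilations exact),
  envelope `1/(2n) ≤ g ≤ 3/(2n)`, and `k = 3` ratio along the tower equal to the constant `3h(3)/h(1) ≠ 1`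
  (`h(1) − 3h(3) = ‖z‖/2 > 0` by Euler's integral at `1 + iτ`; `Γ(1+iτ) ≠ 0`, `3^{iτ} ≠ 1` as `log₂3 ∉ ℤ`).
  Theorem: `Negative.lap_integerDilationLaw_not_of_axisToolkit` (restated below as
  `integerDilationLaw_not_of_axisToolkit`). Reading: the complex-dimension obstruction of F2 survives RP and GKS
  monotonicity along the axis; a proof of S2/Sray must use OFF-AXIS structure of `⟨σ₀σ_x⟩_{β_c}` (e.g. nine-mirror
  RP ACROSS rays, as Rray does) or the Ising equation of state. NOTE the size of the effect: the Laplace kernel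
  damps a `log 2`-periodic modulation by `|Γ(1+iτ)| = (πτ/sinh πτ)^{1/2} ≈ 4·10⁻⁶` — any NUMERICAL test of S2 on the
  axis (idea cards' MC octave ratios) is blind to it at realistic precision.
* F7 NOT PURSUED: a NINE-mirror-RP version of W2/W4 on all of `ℤ³` (radial Källén–Lehmann mixture with density
  `m^{p-2}(1 + ε cos(τ log m))`) needs RP of the Yukawa kernels `e^{-m|x|}/|x|` on `ℤ³`, not in tree
  (`MirrorRPKernel.lean` lists it as NOT here). It would show that nine-mirror RP + cubic symmetry + envelope + T1 +
  S3 still ⊬ S2 (the zoom limits of such a kernel along `2^{-j}` exist and are radial pure powers, so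
  `HRP2Rigidity_of` is no obstruction). Recorded as the natural cycle-2 target.

## Contents
§0 model-blind statements (`PowerLawOf`, `DyadicTowerLawOf`, `IntegerDilationLawAtOf`, `RayDilationLawAtOf`,
`RatioIsotropyOf`, `AngularProfileAtOf`, `AxisPowerLawOf`, `EnvelopeOf`) and `crux_iff`; §1 axis bookkeeping;
§2 W2; §3 W1; §4 W3; §5 assembled separations; §6 F2′ restated from the landed W4 files.

LANDED (theorem-only transcriptions, `--supports stmt-CriticalPhenomena-0634`, namespace
`…Theorems.IsingEuclidUpgradeR2RotInvPowerLaw.Negative`, importable):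
* `Theorems/IsingEuclidUpgradeR2RotInvPowerLaw/Negative/GaugeBookkeeping.lean` — p167473 ACCEPTED (§1 + F1:
  `axisPowerLaw_of_crux`, `criticalTwoPoint_envelope`);
* `…/Negative/LogPeriodicGauge.lean` — p167672 ACCEPTED (F2: `lp_integerDilationLaw_not_of_tower_isotropy_envelope`,
  `lp_crux_not_of_tower_isotropy_envelope`, and the W2 toolkit `lp_*`);
* `…/Negative/DriftingGauge.lean` — p167760 ACCEPTED (F3: `dr_dyadicTowerLaw_not_of_dilation_isotropy_envelope`,
  `dr_crux_not_of_dilation_isotropy_envelope`);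
* `…/Negative/QuarticAnisotropy.lean` — p167736 ACCEPTED (F4: `q_ratioIsotropy_not_of_tower_rayDilation_envelope`,
  `q_crux_not_of_tower_rayDilation_envelope`);
* `…/Negative/LaplaceGauge.lean` — p168166 ACCEPTED (W4 toolkit: `h_bounds`, `h_antitone`, `h_posDef`, `h_two_mul`,
  `h_eq_gamma`, `h_one_sub_three_mul_h_three`, …);
* `…/Negative/LaplaceGaugeSeparation.lean` — p168308 ACCEPTED (F2′: `lap_integerDilationLaw_not_of_axisToolkit`).
In the landed files the witnesses enter through defining hypotheses (`hh`, `hG`), so every `lp_* / dr_* / q_*`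
lemma is directly reusable for other gauges of the same shape.
-/

noncomputable section

namespace Summit.CriticalPhenomena.Ising3DConformalLimit.Cruxes.IsingEuclidUpgradeR2RotInvPowerLaw.Disproof

open Filter Topology Literature.Probability.LatticeModels

/-! ## §0 The crux and the line's stubs, MODEL-BLIND

Every statement of the crux / of line `tower_profile_rigidity` is a property of the single function
`G := criticalTwoPoint 3 : Site 3 → ℝ`. We name these properties with `G` as a parameter; at
`G := criticalTwoPoint 3` they are the route decl / the registered stub texts by `Iff.rfl`. -/

/-- The crux shape: `∃ Δ c > 0, G(x)·|x|₂^{2Δ} → c` cofinitely. -/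
def PowerLawOf (G : Site 3 → ℝ) : Prop :=
  ∃ Δ c : ℝ, 0 < c ∧ Tendsto (fun x : Site 3 => G x * Real.sqrt (∑ i, ((x i : ℝ)) ^ 2) ^ (2 * Δ))
    cofinite (𝓝 c)

/-- The crux IS `PowerLawOf (criticalTwoPoint 3)` (route `IsingEuclidUpgrade`). -/
theorem crux_iff :
    Theses.IsingEuclidUpgrade.IsingEuclidUpgradeR2RotInvPowerLaw ↔ PowerLawOf (criticalTwoPoint 3) :=
  Iff.rfl

/-- The crux IS `PowerLawOf (criticalTwoPoint 3)` (twin decl of route `PrecisionLaplacian`). -/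
theorem crux_iff' :
    Theses.PrecisionLaplacian.IsingEuclidUpgradeR2RotInvPowerLaw ↔ PowerLawOf (criticalTwoPoint 3) :=
  Iff.rfl

/-- T1 of the line, model-blind: the dyadic tower law. -/
def DyadicTowerLawOf (G : Site 3 → ℝ) : Prop :=
  ∃ Δ c : ℝ, 0 < c ∧ Tendsto (fun j : ℕ => G (Pi.single 0 ((2 ^ j : ℕ) : ℤ)) * ((2 ^ j : ℕ) : ℝ) ^ (2 * Δ))
    atTop (𝓝 c)

/-- S2 of the line at exponent `Δ`, model-blind: the integer dilation law along the axis. -/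
def IntegerDilationLawAtOf (G : Site 3 → ℝ) (Δ : ℝ) : Prop :=
  ∀ k : ℕ, 1 ≤ k → Tendsto (fun n : ℕ => G (Pi.single 0 ((k * n : ℕ) : ℤ)) * (k : ℝ) ^ (2 * Δ) /
    G (Pi.single 0 ((n : ℕ) : ℤ))) atTop (𝓝 1)

/-- Sray of the line at exponent `Δ`, model-blind: the integer dilation law along every lattice ray. -/
def RayDilationLawAtOf (G : Site 3 → ℝ) (Δ : ℝ) : Prop :=
  ∀ v : Site 3, v ≠ 0 → ∀ k : ℕ, 1 ≤ k → Tendsto (fun n : ℕ => G (((k * n : ℕ) : ℤ) • v) * (k : ℝ) ^ (2 * Δ) /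
    G (((n : ℕ) : ℤ) • v)) atTop (𝓝 1)

/-- S3 of the line, model-blind: ratio isotropy. -/
def RatioIsotropyOf (G : Site 3 → ℝ) : Prop :=
  Tendsto (fun x : Site 3 => G x / G (Pi.single 0 ((⌊Real.sqrt (∑ i, ((x i : ℝ)) ^ 2)⌋₊ : ℕ) : ℤ)))
    cofinite (𝓝 1)

/-- A of the line at a profile `Ψ`, model-blind: the angular profile statement. -/
def AngularProfileAtOf (G : Site 3 → ℝ) (Ψ : (Fin 3 → ℝ) → ℝ) : Prop :=
  Tendsto (fun x : Site 3 => G x / G (Pi.single 0 ((⌊Real.sqrt (∑ i, ((x i : ℝ)) ^ 2)⌋₊ : ℕ) : ℤ)) -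
    Ψ (fun i => (x i : ℝ) / Real.sqrt (∑ j, ((x j : ℝ)) ^ 2))) cofinite (𝓝 0)

/-- D1 (the axial pure power law), model-blind. -/
def AxisPowerLawOf (G : Site 3 → ℝ) : Prop :=
  ∃ Δ c : ℝ, 0 < c ∧ Tendsto (fun n : ℕ => G (Pi.single 0 ((n : ℕ) : ℤ)) * (n : ℝ) ^ (2 * Δ)) atTop (𝓝 c)

/-- The a-priori envelope of the tree (`criticalTwoPoint_bounds` at `d = 3`, sup norm):
`c‖x‖⁻² ≤ G x ≤ C‖x‖⁻¹` off the origin. -/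
def EnvelopeOf (G : Site 3 → ℝ) : Prop :=
  ∃ c C : ℝ, 0 < c ∧ ∀ x : Site 3, x ≠ 0 →
    c * (‖x‖ : ℝ) ^ (-(2 : ℝ)) ≤ G x ∧ G x ≤ C * (‖x‖ : ℝ) ^ (-(1 : ℝ))

/-- The Ising two-point function lies in the envelope (tree theorem `criticalTwoPoint_bounds_holds`). -/
theorem envelope_criticalTwoPoint : EnvelopeOf (criticalTwoPoint 3) := by
  obtain ⟨c, C, hc, h⟩ := criticalTwoPoint_bounds_holds (d := 3) le_rfl
  refine ⟨c, C, hc, fun x hx => ⟨?_, ?_⟩⟩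
  · convert (h x hx).1 using 3; norm_num
  · convert (h x hx).2 using 3; norm_num

/-! ## §1 Axis bookkeeping -/

theorem sum_sq_single (m : ℤ) :
    (∑ i : Fin 3, (((Pi.single (0 : Fin 3) m : Site 3) i : ℝ)) ^ 2) = (m : ℝ) ^ 2 := by
  simp [Pi.single_apply]

theorem sqrt_sum_sq_single_nat (n : ℕ) :
    Real.sqrt (∑ i : Fin 3, (((Pi.single (0 : Fin 3) ((n : ℕ) : ℤ) : Site 3) i : ℝ)) ^ 2) = n := by
  rw [sum_sq_single]; push_cast; exact Real.sqrt_sq (Nat.cast_nonneg n)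

theorem floor_sqrt_sum_sq_single_nat (n : ℕ) :
    ⌊Real.sqrt (∑ i : Fin 3, (((Pi.single (0 : Fin 3) ((n : ℕ) : ℤ) : Site 3) i : ℝ)) ^ 2)⌋₊ = n := by
  rw [sqrt_sum_sq_single_nat, Nat.floor_natCast]

theorem single_nat_injective :
    Function.Injective (fun n : ℕ => (Pi.single (0 : Fin 3) ((n : ℕ) : ℤ) : Site 3)) := by
  intro a b h
  have := congrFun h 0
  simpa using this

/-- A cofinite limit on `ℤ³` restricts to a limit along the axis `n ↦ n e₀`. -/
theorem tendsto_axis_of_cofinite {F : Site 3 → ℝ} {l : Filter ℝ} (h : Tendsto F cofinite l) :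
    Tendsto (fun n : ℕ => F (Pi.single 0 ((n : ℕ) : ℤ))) atTop l := by
  rw [← Nat.cofinite_eq_atTop]
  exact h.comp single_nat_injective.tendsto_cofinite

/-- The crux shape implies the axial pure power law (restriction to the axis). -/
theorem axisPowerLaw_of_powerLaw {G : Site 3 → ℝ} (h : PowerLawOf G) : AxisPowerLawOf G := by
  obtain ⟨Δ, c, hc, h⟩ := h
  refine ⟨Δ, c, hc, ?_⟩
  refine (tendsto_axis_of_cofinite h).congr fun n => ?_
  simp only [sqrt_sum_sq_single_nat]

/-- The axial pure power law implies the dyadic tower law (restriction to `n = 2^j`). -/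
theorem dyadicTowerLaw_of_axisPowerLaw {G : Site 3 → ℝ} (h : AxisPowerLawOf G) : DyadicTowerLawOf G := by
  obtain ⟨Δ, c, hc, h⟩ := h
  exact ⟨Δ, c, hc, h.comp (tendsto_pow_atTop_atTop_of_one_lt one_lt_two)⟩

/-! ## §2 LOAD-BEARING (the Ising clause, log₂-periodic gauge): T1 ∧ S3 ∧ A ∧ envelope ⇏ S2, ⇏ crux

Witness W2: `G x := h ⌊|x|₂⌋` with the log₂-PERIODIC axis gauge `h n := (2 + cos (2π log₂ n)) / n`.
It is positive, cubic symmetric (a function of `⌊|x|₂⌋`), inside the envelope `‖x‖⁻²/2 ≤ G ≤ 6‖x‖⁻¹`,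
satisfies the dyadic tower law T1 EXACTLY (`G(2^j e₀)·2^j = 3`), ratio isotropy S3 and the angular
profile statement A with `Ψ ≡ 1` IDENTICALLY — and violates the integer dilation law S2 at `k = 3`
(for EVERY exponent `Δ`) and the crux. Reading: the exponent-purity content of S2/Sray (exclusion of a
`log 2`-commensurable log-periodic factor = of a COMPLEX scaling dimension `Δ ± iπ/log 2`) is not a
consequence of T1, S3, A and the envelope; it is where the Ising hypothesis must enter a proof of S2. -/

/-- The log₂-periodic axis gauge `h n = (2 + cos (2π·log₂ n))/n` (value at `n = 0` := value at `1`). -/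
def hLP (n : ℕ) : ℝ :=
  (2 + Real.cos (2 * Real.pi * Real.logb 2 ((max n 1 : ℕ) : ℝ))) / ((max n 1 : ℕ) : ℝ)

/-- Witness W2: the radial-by-floor kernel with the log₂-periodic gauge. -/
def GLP : Site 3 → ℝ := fun x => hLP ⌊Real.sqrt (∑ i, ((x i : ℝ)) ^ 2)⌋₊

theorem hLP_of_one_le {n : ℕ} (hn : 1 ≤ n) :
    hLP n = (2 + Real.cos (2 * Real.pi * Real.logb 2 (n : ℝ))) / (n : ℝ) := by
  simp [hLP, max_eq_left hn]

theorem hLP_pos (n : ℕ) : 0 < hLP n := by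
  unfold hLP
  apply div_pos
  · have := Real.neg_one_le_cos (2 * Real.pi * Real.logb 2 ((max n 1 : ℕ) : ℝ))
    linarith
  · exact_mod_cast (le_max_right n 1)

theorem hLP_le (n : ℕ) : hLP n ≤ 3 / ((max n 1 : ℕ) : ℝ) := by
  unfold hLP
  gcongr
  have := Real.cos_le_one (2 * Real.pi * Real.logb 2 ((max n 1 : ℕ) : ℝ))
  linarith

theorem le_hLP (n : ℕ) : 1 / ((max n 1 : ℕ) : ℝ) ≤ hLP n := by
  unfold hLP
  gcongr
  have := Real.neg_one_le_cos (2 * Real.pi * Real.logb 2 ((max n 1 : ℕ) : ℝ))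
  linarith

/-- Exact discrete scale invariance of the gauge: `h (2n) = h n / 2`. -/
theorem hLP_two_mul {n : ℕ} (hn : 1 ≤ n) : hLP (2 * n) = hLP n / 2 := by
  rw [hLP_of_one_le hn, hLP_of_one_le (by omega)]
  have hn0 : (n : ℝ) ≠ 0 := by exact_mod_cast (by omega : n ≠ 0)
  have hlog : Real.logb 2 ((2 * n : ℕ) : ℝ) = 1 + Real.logb 2 (n : ℝ) := by
    push_cast
    rw [Real.logb_mul two_ne_zero hn0, Real.logb_self_eq_one one_lt_two]
  rw [hlog, mul_add, mul_one, add_comm (2 * Real.pi), Real.cos_add_two_pi]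
  push_cast
  field_simp

/-- On the dyadic tower the gauge is pure: `h (2^j) = 3 / 2^j`. -/
theorem hLP_two_pow (j : ℕ) : hLP (2 ^ j) = 3 / (2 : ℝ) ^ j := by
  rw [hLP_of_one_le Nat.one_le_two_pow]
  have hlog : Real.logb 2 ((2 ^ j : ℕ) : ℝ) = j := by
    push_cast
    rw [← Real.rpow_natCast, Real.logb_rpow two_pos (by norm_num)]
  rw [hlog, show 2 * Real.pi * (j : ℝ) = j * (2 * Real.pi) by ring, Real.cos_nat_mul_two_pi]
  push_cast
  norm_num

/-- On the tower `3·2^j` the gauge carries the phase `2π log₂ 3`: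
`h (3·2^j) = (2 + cos (2π log₂ 3)) / (3·2^j)`. -/
theorem hLP_three_mul_two_pow (j : ℕ) :
    hLP (3 * 2 ^ j) = (2 + Real.cos (2 * Real.pi * Real.logb 2 3)) / (3 * (2 : ℝ) ^ j) := by
  have h1 : 1 ≤ 3 * 2 ^ j := by have := Nat.one_le_two_pow (n := j); omega
  rw [hLP_of_one_le h1]
  have hlog : Real.logb 2 ((3 * 2 ^ j : ℕ) : ℝ) = Real.logb 2 3 + j := by
    push_cast
    rw [Real.logb_mul (by norm_num) (by positivity), ← Real.rpow_natCast,
      Real.logb_rpow two_pos (by norm_num)]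
  rw [hlog, mul_add, show 2 * Real.pi * (j : ℝ) = j * (2 * Real.pi) by ring, Real.cos_add_nat_mul_two_pi]
  push_cast
  ring

/-- `log₂ 3` is not an integer, so `cos (2π log₂ 3) ≠ 1`. -/
theorem cos_two_pi_logb_three_ne_one : Real.cos (2 * Real.pi * Real.logb 2 3) ≠ 1 := by
  intro h
  obtain ⟨m, hm⟩ := (Real.cos_eq_one_iff _).1 h
  have hm' : (m : ℝ) = Real.logb 2 3 := by
    have hpi : (2 * Real.pi) ≠ 0 := by positivity
    have := hm
    field_simp at this
    linarith
  have h1 : (1 : ℝ) < Real.logb 2 3 := by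
    rw [Real.lt_logb_iff_rpow_lt one_lt_two (by norm_num)]; norm_num
  have h2 : Real.logb 2 3 < (2 : ℝ) := by
    rw [Real.logb_lt_iff_lt_rpow one_lt_two (by norm_num)]; norm_num
  rw [← hm'] at h1 h2
  have h1' : (1 : ℤ) < m := by exact_mod_cast h1
  have h2' : m < (2 : ℤ) := by exact_mod_cast h2
  omega

theorem GLP_pos (x : Site 3) : 0 < GLP x := hLP_pos _

theorem GLP_single (n : ℕ) : GLP (Pi.single 0 ((n : ℕ) : ℤ)) = hLP n := by
  simp only [GLP, floor_sqrt_sum_sq_single_nat]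

/-- W2 satisfies ratio isotropy S3 — identically (`G x / G(⌊|x|₂⌋ e₀) = 1`). -/
theorem ratioIsotropy_GLP : RatioIsotropyOf GLP := by
  refine (tendsto_const_nhds (x := (1 : ℝ))).congr fun x => ?_
  simp only [GLP, floor_sqrt_sum_sq_single_nat, div_self (hLP_pos _).ne']

/-- W2 satisfies the angular profile statement A with the constant profile `Ψ ≡ 1` — identically. -/
theorem angularProfile_GLP : AngularProfileAtOf GLP (fun _ => 1) := by
  refine (tendsto_const_nhds (x := (0 : ℝ))).congr fun x => ?_
  simp only [GLP, floor_sqrt_sum_sq_single_nat, div_self (hLP_pos _).ne', sub_self]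

/-- W2 satisfies the dyadic tower law T1 EXACTLY: `G(2^j e₀)·(2^j)^{2·(1/2)} = 3`. -/
theorem dyadicTowerLaw_GLP : DyadicTowerLawOf GLP := by
  refine ⟨1 / 2, 3, by norm_num, ?_⟩
  refine (tendsto_const_nhds (x := (3 : ℝ))).congr fun j => ?_
  rw [GLP_single, hLP_two_pow, show (2 : ℝ) * (1 / 2) = 1 by norm_num, Real.rpow_one]
  push_cast
  field_simp

/-! ### Norm bookkeeping on `ℤ³` (sup norm `‖x‖` of the tree's envelope versus `|x|₂`) -/

theorem one_le_norm_of_ne_zero {x : Site 3} (hx : x ≠ 0) : (1 : ℝ) ≤ ‖x‖ := by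
  obtain ⟨i, hi⟩ : ∃ i, x i ≠ 0 := by
    by_contra h
    push Not at h
    exact hx (funext h)
  calc (1 : ℝ) ≤ ‖x i‖ := by rw [Int.norm_eq_abs]; exact_mod_cast Int.one_le_abs hi
    _ ≤ ‖x‖ := norm_le_pi_norm x i

theorem norm_le_sqrt_sum_sq (x : Site 3) : ‖x‖ ≤ Real.sqrt (∑ i, ((x i : ℝ)) ^ 2) := by
  refine (pi_norm_le_iff_of_nonneg (Real.sqrt_nonneg _)).2 fun i => ?_
  rw [Int.norm_eq_abs, ← Real.sqrt_sq_eq_abs]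
  exact Real.sqrt_le_sqrt (Finset.single_le_sum (f := fun j => ((x j : ℝ)) ^ 2)
    (fun j _ => sq_nonneg _) (Finset.mem_univ i))

theorem sqrt_sum_sq_le (x : Site 3) : Real.sqrt (∑ i, ((x i : ℝ)) ^ 2) ≤ Real.sqrt 3 * ‖x‖ := by
  have h : ∀ i, ((x i : ℝ)) ^ 2 ≤ ‖x‖ ^ 2 := fun i => by
    have h1 : |(x i : ℝ)| ≤ ‖x‖ := by rw [← Int.norm_eq_abs]; exact norm_le_pi_norm x i
    have h2 : 0 ≤ ‖x‖ := norm_nonneg _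
    nlinarith [abs_nonneg ((x i : ℝ)), sq_abs ((x i : ℝ))]
  calc Real.sqrt (∑ i, ((x i : ℝ)) ^ 2) ≤ Real.sqrt (3 * ‖x‖ ^ 2) := by
        refine Real.sqrt_le_sqrt ?_
        calc (∑ i, ((x i : ℝ)) ^ 2) ≤ ∑ _i : Fin 3, ‖x‖ ^ 2 := Finset.sum_le_sum fun i _ => h i
          _ = 3 * ‖x‖ ^ 2 := by simp
    _ = Real.sqrt 3 * ‖x‖ := by rw [Real.sqrt_mul' _ (sq_nonneg _), Real.sqrt_sq (norm_nonneg _)]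

/-- The floor radius `n = ⌊|x|₂⌋` of `x ≠ 0`: `1 ≤ n`, `n ≤ |x|₂`, `|x|₂ ≤ 2n`, `‖x‖ ≤ |x|₂ ≤ √3‖x‖`. -/
theorem floor_radius_bounds {x : Site 3} (hx : x ≠ 0) :
    1 ≤ ⌊Real.sqrt (∑ i, ((x i : ℝ)) ^ 2)⌋₊ ∧
    ((⌊Real.sqrt (∑ i, ((x i : ℝ)) ^ 2)⌋₊ : ℕ) : ℝ) ≤ Real.sqrt (∑ i, ((x i : ℝ)) ^ 2) ∧
    Real.sqrt (∑ i, ((x i : ℝ)) ^ 2) ≤ 2 * ((⌊Real.sqrt (∑ i, ((x i : ℝ)) ^ 2)⌋₊ : ℕ) : ℝ) := by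
  set r := Real.sqrt (∑ i, ((x i : ℝ)) ^ 2) with hr
  have hr1 : 1 ≤ r := le_trans (one_le_norm_of_ne_zero hx) (norm_le_sqrt_sum_sq x)
  have hn1 : 1 ≤ ⌊r⌋₊ := Nat.le_floor (by exact_mod_cast hr1)
  refine ⟨hn1, Nat.floor_le (by linarith), ?_⟩
  have hlt : r < (⌊r⌋₊ : ℝ) + 1 := Nat.lt_floor_add_one r
  have hn1' : (1 : ℝ) ≤ (⌊r⌋₊ : ℝ) := by exact_mod_cast hn1
  linarith

/-- W2 lies in the a-priori envelope: `‖x‖⁻²/2 ≤ G x ≤ 6‖x‖⁻¹` off the origin. -/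
theorem envelope_GLP : EnvelopeOf GLP := by
  refine ⟨1 / 2, 6, by norm_num, fun x hx => ?_⟩
  obtain ⟨hn1, hnr, hrn⟩ := floor_radius_bounds hx
  set r := Real.sqrt (∑ i, ((x i : ℝ)) ^ 2) with hr
  set n := ⌊r⌋₊ with hn
  have hx1 : (1 : ℝ) ≤ ‖x‖ := one_le_norm_of_ne_zero hx
  have hxr : ‖x‖ ≤ r := norm_le_sqrt_sum_sq x
  have hr3 : r ≤ Real.sqrt 3 * ‖x‖ := sqrt_sum_sq_le x
  have hnpos : (0 : ℝ) < n := by exact_mod_cast hn1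
  have hmax : ((max n 1 : ℕ) : ℝ) = n := by rw [max_eq_left hn1]
  have hG : GLP x = hLP n := rfl
  have hs3 : Real.sqrt 3 ≤ 2 := by
    rw [Real.sqrt_le_iff]; norm_num
  constructor
  · -- lower bound
    have h1 : 1 / (n : ℝ) ≤ hLP n := by simpa only [hmax] using le_hLP n
    rw [hG, Real.rpow_neg (by linarith), Real.rpow_two]
    calc 1 / 2 * (‖x‖ ^ 2)⁻¹ = 1 / (2 * ‖x‖ * ‖x‖) := by field_simp
      _ ≤ 1 / (Real.sqrt 3 * ‖x‖) := by
          apply one_div_le_one_div_of_le (by positivity)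
          nlinarith
      _ ≤ 1 / r := one_div_le_one_div_of_le (by linarith) hr3
      _ ≤ 1 / (n : ℝ) := one_div_le_one_div_of_le hnpos hnr
      _ ≤ hLP n := h1
  · -- upper bound
    have h1 : hLP n ≤ 3 / (n : ℝ) := by simpa only [hmax] using hLP_le n
    rw [hG, Real.rpow_neg_one]
    calc hLP n ≤ 3 / (n : ℝ) := h1
      _ = 6 / (2 * (n : ℝ)) := by field_simp; ring
      _ ≤ 6 / r := div_le_div_of_nonneg_left (by norm_num) (by linarith) hrn
      _ ≤ 6 / ‖x‖ := div_le_div_of_nonneg_left (by norm_num) (by linarith) hxr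
      _ = 6 * ‖x‖⁻¹ := by rw [div_eq_mul_inv]

/-- **W2 violates S2 at every exponent**: `k = 2` forces `2Δ = 1`, and then along the dyadic tower the
`k = 3` ratio is the constant `(2 + cos (2π log₂ 3))/3 ≠ 1`. -/
theorem not_integerDilationLaw_GLP (Δ : ℝ) : ¬ IntegerDilationLawAtOf GLP Δ := by
  intro h
  -- k = 2 forces 2^(2Δ) = 2
  have h2 := h 2 (by norm_num)
  have e2 : ∀ n : ℕ, 1 ≤ n → GLP (Pi.single 0 ((2 * n : ℕ) : ℤ)) * ((2 : ℕ) : ℝ) ^ (2 * Δ) /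
      GLP (Pi.single 0 ((n : ℕ) : ℤ)) = (2 : ℝ) ^ (2 * Δ) / 2 := by
    intro n hn
    rw [GLP_single, GLP_single, hLP_two_mul hn]
    have := (hLP_pos n).ne'
    push_cast
    field_simp
  have lim2 : Tendsto (fun n : ℕ => GLP (Pi.single 0 ((2 * n : ℕ) : ℤ)) * ((2 : ℕ) : ℝ) ^ (2 * Δ) /
      GLP (Pi.single 0 ((n : ℕ) : ℤ))) atTop (𝓝 ((2 : ℝ) ^ (2 * Δ) / 2)) :=
    tendsto_const_nhds.congr' ((eventually_ge_atTop 1).mono fun n hn => (e2 n hn).symm)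
  have key : (2 : ℝ) ^ (2 * Δ) / 2 = 1 := tendsto_nhds_unique lim2 h2
  have hΔ : 2 * Δ = 1 := by
    have h22 : (2 : ℝ) ^ (2 * Δ) = 2 := by linarith
    have := congrArg (Real.logb 2) h22
    rwa [Real.logb_rpow two_pos (by norm_num), Real.logb_self_eq_one one_lt_two] at this
  -- k = 3 along the dyadic tower
  have h3 := (h 3 (by norm_num)).comp (tendsto_pow_atTop_atTop_of_one_lt one_lt_two)
  have e3 : ((fun n : ℕ => GLP (Pi.single 0 ((3 * n : ℕ) : ℤ)) * ((3 : ℕ) : ℝ) ^ (2 * Δ) /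
      GLP (Pi.single 0 ((n : ℕ) : ℤ))) ∘ fun j : ℕ => 2 ^ j) =
      fun _ => (2 + Real.cos (2 * Real.pi * Real.logb 2 3)) / 3 := by
    funext j
    simp only [Function.comp_apply]
    rw [GLP_single, GLP_single, hLP_three_mul_two_pow, hLP_two_pow, hΔ]
    push_cast
    rw [Real.rpow_one]
    field_simp
  rw [e3] at h3
  have h13 := tendsto_nhds_unique h3 tendsto_const_nhds
  apply cos_two_pi_logb_three_ne_one
  field_simp at h13
  linarith

/-- **W2 violates the crux**: doubling along the axis forces `2Δ = 1`; the towers `2^j` and `3·2^j` then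
give the two different limits `3` and `2 + cos (2π log₂ 3)`. -/
theorem not_powerLaw_GLP : ¬ PowerLawOf GLP := by
  intro hP
  obtain ⟨Δ, c, hc, h⟩ := axisPowerLaw_of_powerLaw hP
  -- doubling along the axis
  have hmono : StrictMono fun n : ℕ => 2 * n := fun a b hab => by dsimp only; omega
  have hd := h.comp hmono.tendsto_atTop
  have e : ∀ n : ℕ, 1 ≤ n → GLP (Pi.single 0 ((2 * n : ℕ) : ℤ)) * ((2 * n : ℕ) : ℝ) ^ (2 * Δ) =
      (2 : ℝ) ^ (2 * Δ) / 2 * (GLP (Pi.single 0 ((n : ℕ) : ℤ)) * (n : ℝ) ^ (2 * Δ)) := by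
    intro n hn
    rw [GLP_single, GLP_single, hLP_two_mul hn]
    push_cast
    rw [Real.mul_rpow (by norm_num) (Nat.cast_nonneg n)]
    ring
  have hd' : Tendsto (fun n : ℕ => GLP (Pi.single 0 ((2 * n : ℕ) : ℤ)) * ((2 * n : ℕ) : ℝ) ^ (2 * Δ))
      atTop (𝓝 ((2 : ℝ) ^ (2 * Δ) / 2 * c)) :=
    (h.const_mul _).congr' ((eventually_ge_atTop 1).mono fun n hn => (e n hn).symm)
  have key : (2 : ℝ) ^ (2 * Δ) / 2 * c = c := tendsto_nhds_unique hd' hd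
  have hΔ : 2 * Δ = 1 := by
    have h1 : (2 : ℝ) ^ (2 * Δ) / 2 = 1 := by
      have := mul_right_cancel₀ hc.ne' (key.trans (one_mul c).symm)
      exact this
    have h22 : (2 : ℝ) ^ (2 * Δ) = 2 := by linarith
    have := congrArg (Real.logb 2) h22
    rwa [Real.logb_rpow two_pos (by norm_num), Real.logb_self_eq_one one_lt_two] at this
  -- the dyadic tower: value 3
  have t1 := h.comp (tendsto_pow_atTop_atTop_of_one_lt one_lt_two)
  have e1 : ((fun n : ℕ => GLP (Pi.single 0 ((n : ℕ) : ℤ)) * (n : ℝ) ^ (2 * Δ)) ∘ fun j : ℕ => 2 ^ j) =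
      fun _ => (3 : ℝ) := by
    funext j
    simp only [Function.comp_apply]
    rw [GLP_single, hLP_two_pow, hΔ]
    push_cast
    rw [Real.rpow_one]
    field_simp
  rw [e1] at t1
  have hc3 : c = 3 := tendsto_nhds_unique t1 tendsto_const_nhds
  -- the tower 3·2^j: value 2 + cos (2π log₂ 3)
  have hmono3 : StrictMono fun j : ℕ => 3 * 2 ^ j := fun a b hab => by
    have : 2 ^ a < 2 ^ b := Nat.pow_lt_pow_right (by norm_num) hab
    dsimp only
    omega
  have t3 := h.comp hmono3.tendsto_atTop
  have e3 : ((fun n : ℕ => GLP (Pi.single 0 ((n : ℕ) : ℤ)) * (n : ℝ) ^ (2 * Δ)) ∘ fun j : ℕ => 3 * 2 ^ j) =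
      fun _ => 2 + Real.cos (2 * Real.pi * Real.logb 2 3) := by
    funext j
    simp only [Function.comp_apply]
    rw [GLP_single, hLP_three_mul_two_pow, hΔ]
    push_cast
    rw [Real.rpow_one]
    field_simp
  rw [e3] at t3
  have hc' : c = 2 + Real.cos (2 * Real.pi * Real.logb 2 3) := tendsto_nhds_unique t3 tendsto_const_nhds
  exact cos_two_pi_logb_three_ne_one (by linarith)

/-! ## §3 LOAD-BEARING (the Ising clause, drifting gauge): S2 ∧ S3 ∧ A ∧ envelope ⇏ T1, ⇏ crux

Witness W1: `G x := h ⌊|x|₂⌋` with the DRIFTING axis gauge `h n := 1/(n (1 + log n))` (a log correction).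
It is positive, cubic symmetric, inside the envelope `‖x‖⁻²/3 ≤ G ≤ 2‖x‖⁻¹`, satisfies the integer
dilation law S2 at `Δ = 1/2` for every `k`, ratio isotropy S3 and A (`Ψ ≡ 1`) identically — and violates the
dyadic tower law T1 (hence the axial law D1 and the crux). Reading: the PURITY content of T1 (no slowly
drifting factor along one tower) is not a consequence of S2, S3, A and the envelope. -/

/-- The drifting axis gauge `h n = 1 / (n (1 + log n))` (value at `n = 0` := value at `1`). -/
def hDR (n : ℕ) : ℝ := 1 / (((max n 1 : ℕ) : ℝ) * (1 + Real.log ((max n 1 : ℕ) : ℝ)))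

/-- Witness W1: the radial-by-floor kernel with the drifting gauge. -/
def GDR : Site 3 → ℝ := fun x => hDR ⌊Real.sqrt (∑ i, ((x i : ℝ)) ^ 2)⌋₊

theorem hDR_of_one_le {n : ℕ} (hn : 1 ≤ n) : hDR n = 1 / ((n : ℝ) * (1 + Real.log n)) := by
  simp [hDR, max_eq_left hn]

theorem one_le_one_add_log_max (n : ℕ) : (1 : ℝ) ≤ 1 + Real.log ((max n 1 : ℕ) : ℝ) := by
  have : (0 : ℝ) ≤ Real.log ((max n 1 : ℕ) : ℝ) := Real.log_nonneg (by exact_mod_cast le_max_right n 1)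
  linarith

theorem hDR_pos (n : ℕ) : 0 < hDR n := by
  unfold hDR
  have h1 := one_le_one_add_log_max n
  have h2 : (1 : ℝ) ≤ ((max n 1 : ℕ) : ℝ) := by exact_mod_cast le_max_right n 1
  positivity

theorem hDR_le (n : ℕ) : hDR n ≤ 1 / ((max n 1 : ℕ) : ℝ) := by
  unfold hDR
  have h1 := one_le_one_add_log_max n
  have h2 : (1 : ℝ) ≤ ((max n 1 : ℕ) : ℝ) := by exact_mod_cast le_max_right n 1
  rw [one_div_le_one_div (by positivity) (by positivity)]
  nlinarith

theorem le_hDR (n : ℕ) : 1 / ((max n 1 : ℕ) : ℝ) ^ 2 ≤ hDR n := by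
  unfold hDR
  have h2 : (1 : ℝ) ≤ ((max n 1 : ℕ) : ℝ) := by exact_mod_cast le_max_right n 1
  have h1 := one_le_one_add_log_max n
  have h3 : 1 + Real.log ((max n 1 : ℕ) : ℝ) ≤ ((max n 1 : ℕ) : ℝ) := by
    have := Real.add_one_le_exp (Real.log ((max n 1 : ℕ) : ℝ))
    rw [Real.exp_log (by positivity)] at this
    linarith
  rw [one_div_le_one_div (by positivity) (by positivity), sq]
  gcongr

theorem GDR_pos (x : Site 3) : 0 < GDR x := hDR_pos _

theorem GDR_single (n : ℕ) : GDR (Pi.single 0 ((n : ℕ) : ℤ)) = hDR n := by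
  simp only [GDR, floor_sqrt_sum_sq_single_nat]

/-- W1 satisfies ratio isotropy S3 identically. -/
theorem ratioIsotropy_GDR : RatioIsotropyOf GDR := by
  refine (tendsto_const_nhds (x := (1 : ℝ))).congr fun x => ?_
  simp only [GDR, floor_sqrt_sum_sq_single_nat, div_self (hDR_pos _).ne']

/-- W1 satisfies A with `Ψ ≡ 1` identically. -/
theorem angularProfile_GDR : AngularProfileAtOf GDR (fun _ => 1) := by
  refine (tendsto_const_nhds (x := (0 : ℝ))).congr fun x => ?_
  simp only [GDR, floor_sqrt_sum_sq_single_nat, div_self (hDR_pos _).ne', sub_self]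

/-- W1 lies in the envelope: `‖x‖⁻²/3 ≤ G x ≤ 2‖x‖⁻¹`. -/
theorem envelope_GDR : EnvelopeOf GDR := by
  refine ⟨1 / 3, 2, by norm_num, fun x hx => ?_⟩
  obtain ⟨hn1, hnr, hrn⟩ := floor_radius_bounds hx
  set r := Real.sqrt (∑ i, ((x i : ℝ)) ^ 2) with hr
  set n := ⌊r⌋₊ with hn
  have hx1 : (1 : ℝ) ≤ ‖x‖ := one_le_norm_of_ne_zero hx
  have hxr : ‖x‖ ≤ r := norm_le_sqrt_sum_sq x
  have hr3 : r ≤ Real.sqrt 3 * ‖x‖ := sqrt_sum_sq_le x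
  have hnpos : (0 : ℝ) < n := by exact_mod_cast hn1
  have hmax : ((max n 1 : ℕ) : ℝ) = n := by rw [max_eq_left hn1]
  have hG : GDR x = hDR n := rfl
  have hs3 : Real.sqrt 3 ^ 2 = 3 := Real.sq_sqrt (by norm_num)
  constructor
  · have h1 : 1 / (n : ℝ) ^ 2 ≤ hDR n := by simpa only [hmax] using le_hDR n
    rw [hG, Real.rpow_neg (by linarith), Real.rpow_two]
    calc 1 / 3 * (‖x‖ ^ 2)⁻¹ = 1 / ((Real.sqrt 3 * ‖x‖) ^ 2) := by rw [mul_pow, hs3]; field_simp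
      _ ≤ 1 / r ^ 2 := by
          apply one_div_le_one_div_of_le (pow_pos (by linarith) 2)
          exact pow_le_pow_left₀ (by linarith) hr3 2
      _ ≤ 1 / (n : ℝ) ^ 2 := by
          apply one_div_le_one_div_of_le (by positivity)
          exact pow_le_pow_left₀ hnpos.le hnr 2
      _ ≤ hDR n := h1
  · have h1 : hDR n ≤ 1 / (n : ℝ) := by simpa only [hmax] using hDR_le n
    rw [hG, Real.rpow_neg_one]
    calc hDR n ≤ 1 / (n : ℝ) := h1
      _ = 2 / (2 * (n : ℝ)) := by field_simp
      _ ≤ 2 / r := div_le_div_of_nonneg_left (by norm_num) (by linarith) hrn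
      _ ≤ 2 / ‖x‖ := div_le_div_of_nonneg_left (by norm_num) (by linarith) hxr
      _ = 2 * ‖x‖⁻¹ := by rw [div_eq_mul_inv]

/-- `(1 + u n)/(a + u n) → 1` when `u → +∞`. -/
theorem tendsto_one_add_div_add {u : ℕ → ℝ} (hu : Tendsto u atTop atTop) (a : ℝ) :
    Tendsto (fun n => (1 + u n) / (a + u n)) atTop (𝓝 1) := by
  have hden : Tendsto (fun n => a + u n) atTop atTop := tendsto_atTop_add_const_left _ _ hu
  have h0 : Tendsto (fun n => (1 - a) / (a + u n)) atTop (𝓝 0) := tendsto_const_nhds.div_atTop hden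
  have h1 : Tendsto (fun n => 1 + (1 - a) / (a + u n)) atTop (𝓝 (1 + 0)) := tendsto_const_nhds.add h0
  rw [add_zero] at h1
  refine h1.congr' ?_
  filter_upwards [hden.eventually_gt_atTop 0] with n hn
  field_simp
  ring

/-- W1 satisfies the integer dilation law S2 at `Δ = 1/2`, for every `k ≥ 1`. -/
theorem integerDilationLaw_GDR : IntegerDilationLawAtOf GDR (1 / 2) := by
  intro k hk
  have hk0 : (0 : ℝ) < k := by exact_mod_cast hk
  have hlog : Tendsto (fun n : ℕ => Real.log (n : ℝ)) atTop atTop :=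
    Real.tendsto_log_atTop.comp tendsto_natCast_atTop_atTop
  have hlim := tendsto_one_add_div_add hlog (1 + Real.log k)
  refine hlim.congr' ?_
  filter_upwards [eventually_ge_atTop 1] with n hn
  have hn0 : (0 : ℝ) < n := by exact_mod_cast hn
  have hkn : 1 ≤ k * n := le_trans hk (Nat.le_mul_of_pos_right k hn)
  rw [GDR_single, GDR_single, hDR_of_one_le hkn, hDR_of_one_le hn,
    show (2 : ℝ) * (1 / 2) = 1 by norm_num, Real.rpow_one]
  push_cast
  rw [Real.log_mul hk0.ne' hn0.ne']
  have h1 : 0 < 1 + Real.log k + Real.log n := by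
    have := Real.log_nonneg (show (1 : ℝ) ≤ k by exact_mod_cast hk)
    have := Real.log_nonneg (show (1 : ℝ) ≤ n by exact_mod_cast hn)
    linarith
  have h2 : 0 < 1 + Real.log n := by
    have := Real.log_nonneg (show (1 : ℝ) ≤ n by exact_mod_cast hn)
    linarith
  field_simp
  ring

/-- **W1 violates T1**: if `h(2^j)(2^j)^{2Δ} → c > 0` then the ratio of consecutive terms tends to `1`
and equals `2^{2Δ-1}(1 + j log 2)/(1 + (j+1) log 2) → 2^{2Δ-1}`, so `2Δ = 1`; but then the terms are
`1/(1 + j log 2) → 0 ≠ c`. -/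
theorem not_dyadicTowerLaw_GDR : ¬ DyadicTowerLawOf GDR := by
  rintro ⟨Δ, c, hc, h⟩
  have hL : 0 < Real.log 2 := Real.log_pos one_lt_two
  -- the terms, explicitly
  have e : ∀ j : ℕ, GDR (Pi.single 0 ((2 ^ j : ℕ) : ℤ)) * ((2 ^ j : ℕ) : ℝ) ^ (2 * Δ) =
      (2 : ℝ) ^ ((2 * Δ - 1) * j) / (1 + j * Real.log 2) := by
    intro j
    rw [GDR_single, hDR_of_one_le Nat.one_le_two_pow]
    push_cast
    rw [Real.log_pow, ← Real.rpow_natCast 2 j, ← Real.rpow_mul (by norm_num), sub_mul,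
      Real.rpow_sub two_pos, mul_comm (j : ℝ) (2 * Δ), one_mul]
    have h1 : (0 : ℝ) < (2 : ℝ) ^ (j : ℝ) := by positivity
    have h2 : 0 < 1 + (j : ℝ) * Real.log 2 := by nlinarith [hL, (Nat.cast_nonneg j : (0:ℝ) ≤ j)]
    field_simp
  have hj : Tendsto (fun j : ℕ => (j : ℝ) * Real.log 2) atTop atTop :=
    tendsto_natCast_atTop_atTop.atTop_mul_const hL
  -- ratio of consecutive terms → c / c = 1
  have hratio : Tendsto (fun j : ℕ => (GDR (Pi.single 0 ((2 ^ (j + 1) : ℕ) : ℤ)) *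
      ((2 ^ (j + 1) : ℕ) : ℝ) ^ (2 * Δ)) / (GDR (Pi.single 0 ((2 ^ j : ℕ) : ℤ)) * ((2 ^ j : ℕ) : ℝ) ^ (2 * Δ)))
      atTop (𝓝 (c / c)) := (h.comp (tendsto_add_atTop_nat 1)).div h hc.ne'
  rw [div_self hc.ne'] at hratio
  -- ratio of consecutive terms → 2^(2Δ-1)
  have hratio' : Tendsto (fun j : ℕ => (GDR (Pi.single 0 ((2 ^ (j + 1) : ℕ) : ℤ)) *
      ((2 ^ (j + 1) : ℕ) : ℝ) ^ (2 * Δ)) / (GDR (Pi.single 0 ((2 ^ j : ℕ) : ℤ)) * ((2 ^ j : ℕ) : ℝ) ^ (2 * Δ)))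
      atTop (𝓝 ((2 : ℝ) ^ (2 * Δ - 1) * 1)) := by
    have hq : Tendsto (fun j : ℕ => (1 + (j : ℝ) * Real.log 2) / (1 + Real.log 2 + (j : ℝ) * Real.log 2))
        atTop (𝓝 1) := tendsto_one_add_div_add hj _
    refine ((tendsto_const_nhds (x := (2 : ℝ) ^ (2 * Δ - 1))).mul hq).congr' ?_
    filter_upwards with j
    rw [e, e]
    push_cast
    rw [mul_add, mul_one, Real.rpow_add two_pos]
    have h1 : (0 : ℝ) < (2 : ℝ) ^ ((2 * Δ - 1) * j) := by positivity
    have h2 : 0 < 1 + (j : ℝ) * Real.log 2 := by nlinarith [hL, (Nat.cast_nonneg j : (0:ℝ) ≤ j)]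
    have h3 : 0 < 1 + ((j : ℝ) + 1) * Real.log 2 := by nlinarith [hL, (Nat.cast_nonneg j : (0:ℝ) ≤ j)]
    field_simp
    ring
  rw [mul_one] at hratio'
  have key : (2 : ℝ) ^ (2 * Δ - 1) = 1 := tendsto_nhds_unique hratio' hratio
  have hΔ : 2 * Δ - 1 = 0 := by
    have := congrArg (Real.logb 2) key
    rwa [Real.logb_rpow two_pos (by norm_num), Real.logb_one] at this
  -- with 2Δ = 1 the terms tend to 0
  have h0 : Tendsto (fun j : ℕ => GDR (Pi.single 0 ((2 ^ j : ℕ) : ℤ)) * ((2 ^ j : ℕ) : ℝ) ^ (2 * Δ))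
      atTop (𝓝 0) := by
    have := (tendsto_const_nhds (x := (1 : ℝ))).div_atTop (tendsto_atTop_add_const_left _ (1 : ℝ) hj)
    refine this.congr' ?_
    filter_upwards with j
    rw [e, hΔ, zero_mul, Real.rpow_zero]
  exact hc.ne' (tendsto_nhds_unique h h0)

/-- Hence W1 violates the axial law D1 and the crux. -/
theorem not_powerLaw_GDR : ¬ PowerLawOf GDR := fun h =>
  not_dyadicTowerLaw_GDR (dyadicTowerLaw_of_axisPowerLaw (axisPowerLaw_of_powerLaw h))

/-! ## §4 LOAD-BEARING (reflection positivity in R / Rray): T1 ∧ Sray ∧ envelope ∧ cubic symmetry ⇏ S3, ⇏ crux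

Witness W3: the QUARTIC kernel `G x := (Σ xᵢ⁴)/(Σ xᵢ²)³` (values `max(·,1)` so that `G 0 = 1`; off the
origin of `ℤ³` the maxima are identities). It is positive, hyperoctahedrally symmetric, EXACTLY homogeneous
of degree `-2` along every lattice ray (so T1 at `Δ = 1` and the ray dilation law Sray at `Δ = 1` hold with
constant sequences), inside the envelope `‖x‖⁻²/9 ≤ G ≤ ‖x‖⁻¹` — and its angular profile
`(Σ uᵢ⁴)` is not constant: ratio isotropy S3 fails (diagonal/axis ratio `→ 1/3`) and so does the crux.
Reading: the transfers R / Rray are NOT consequences of the dilation laws, the envelope and cubic symmetry;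
their proofs (landed: `stub_rayRigidityTransfer` via `pairLimit_of_rayRV` / `HRP2Rigidity_of`) must and do
use nine-mirror reflection positivity of `criticalTwoPoint 3` — W3 is the HRP2 disprover's quartic witness
`hrp2Rigidity_false_without_RP` transported to this crux. -/

/-- Witness W3: the quartic anisotropic kernel (with `max(·,1)` guards, identities off the origin). -/
def GQ : Site 3 → ℝ := fun x => max (∑ i, ((x i : ℝ)) ^ 4) 1 / (max (∑ i, ((x i : ℝ)) ^ 2) 1) ^ 3

theorem one_le_sum_sq_of_ne_zero {x : Site 3} (hx : x ≠ 0) : (1 : ℝ) ≤ ∑ i, ((x i : ℝ)) ^ 2 := by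
  obtain ⟨i, hi⟩ : ∃ i, x i ≠ 0 := by
    by_contra h
    push Not at h
    exact hx (funext h)
  have h1 : (1 : ℝ) ≤ ((x i : ℝ)) ^ 2 := by
    have : (1 : ℤ) ≤ (x i) ^ 2 := by nlinarith [Int.one_le_abs hi, sq_abs (x i)]
    exact_mod_cast this
  exact le_trans h1 (Finset.single_le_sum (f := fun j => ((x j : ℝ)) ^ 2) (fun j _ => sq_nonneg _)
    (Finset.mem_univ i))

theorem one_le_sum_fourth_of_ne_zero {x : Site 3} (hx : x ≠ 0) : (1 : ℝ) ≤ ∑ i, ((x i : ℝ)) ^ 4 := by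
  obtain ⟨i, hi⟩ : ∃ i, x i ≠ 0 := by
    by_contra h
    push Not at h
    exact hx (funext h)
  have h1 : (1 : ℝ) ≤ ((x i : ℝ)) ^ 4 := by
    have : (1 : ℤ) ≤ (x i) ^ 4 := by
      have h2 : (1 : ℤ) ≤ (x i) ^ 2 := by nlinarith [Int.one_le_abs hi, sq_abs (x i)]
      nlinarith
    exact_mod_cast this
  exact le_trans h1 (Finset.single_le_sum (f := fun j => ((x j : ℝ)) ^ 4) (fun j _ => by positivity)
    (Finset.mem_univ i))

theorem GQ_of_ne_zero {x : Site 3} (hx : x ≠ 0) :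
    GQ x = (∑ i, ((x i : ℝ)) ^ 4) / (∑ i, ((x i : ℝ)) ^ 2) ^ 3 := by
  simp only [GQ, max_eq_left (one_le_sum_sq_of_ne_zero hx), max_eq_left (one_le_sum_fourth_of_ne_zero hx)]

theorem GQ_pos (x : Site 3) : 0 < GQ x := by
  unfold GQ
  positivity

/-- Hyperoctahedral symmetry of W3: invariance under all signed coordinate permutations. -/
theorem GQ_symm (σ : Equiv.Perm (Fin 3)) (ε : Fin 3 → ℤ) (hε : ∀ i, ε i = 1 ∨ ε i = -1) (x : Site 3) :
    GQ (fun i => ε i * x (σ i)) = GQ x := by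
  have h4 : (∑ i, (((ε i * x (σ i) : ℤ) : ℝ)) ^ 4) = ∑ i, ((x i : ℝ)) ^ 4 := by
    have : ∀ i, (((ε i * x (σ i) : ℤ) : ℝ)) ^ 4 = ((x (σ i) : ℝ)) ^ 4 := fun i => by
      rcases hε i with h | h
      · simp [h]
      · simp [h]; ring
    simp_rw [this]
    exact Equiv.sum_comp σ (fun j => ((x j : ℝ)) ^ 4)
  have h2 : (∑ i, (((ε i * x (σ i) : ℤ) : ℝ)) ^ 2) = ∑ i, ((x i : ℝ)) ^ 2 := by
    have : ∀ i, (((ε i * x (σ i) : ℤ) : ℝ)) ^ 2 = ((x (σ i) : ℝ)) ^ 2 := fun i => by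
      rcases hε i with h | h <;> simp [h]
    simp_rw [this]
    exact Equiv.sum_comp σ (fun j => ((x j : ℝ)) ^ 2)
  simp only [GQ, h4, h2]

/-- Exact homogeneity of degree `-2` along lattice rays: `G (m • v) = G v / m²`. -/
theorem GQ_zsmul {v : Site 3} (hv : v ≠ 0) {m : ℤ} (hm : m ≠ 0) : GQ (m • v) = GQ v / (m : ℝ) ^ 2 := by
  have hmv : m • v ≠ 0 := smul_ne_zero hm hv
  rw [GQ_of_ne_zero hmv, GQ_of_ne_zero hv]
  have h4 : (∑ i, ((((m • v) i : ℤ) : ℝ)) ^ 4) = (m : ℝ) ^ 4 * ∑ i, ((v i : ℝ)) ^ 4 := by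
    rw [Finset.mul_sum]
    refine Finset.sum_congr rfl fun i _ => ?_
    simp only [Pi.smul_apply, smul_eq_mul, Int.cast_mul]
    ring
  have h2 : (∑ i, ((((m • v) i : ℤ) : ℝ)) ^ 2) = (m : ℝ) ^ 2 * ∑ i, ((v i : ℝ)) ^ 2 := by
    rw [Finset.mul_sum]
    refine Finset.sum_congr rfl fun i _ => ?_
    simp only [Pi.smul_apply, smul_eq_mul, Int.cast_mul]
    ring
  rw [h4, h2]
  have hS : (0 : ℝ) < ∑ i, ((v i : ℝ)) ^ 2 := lt_of_lt_of_le one_pos (one_le_sum_sq_of_ne_zero hv)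
  have hm' : (m : ℝ) ≠ 0 := by exact_mod_cast hm
  field_simp

theorem single_nat_ne_zero {n : ℕ} (hn : 1 ≤ n) : (Pi.single (0 : Fin 3) ((n : ℕ) : ℤ) : Site 3) ≠ 0 := by
  intro h
  have := congrFun h 0
  simp at this
  omega

/-- On the axis: `G (n e₀) = 1/n²`. -/
theorem GQ_single {n : ℕ} (hn : 1 ≤ n) : GQ (Pi.single 0 ((n : ℕ) : ℤ)) = 1 / (n : ℝ) ^ 2 := by
  rw [GQ_of_ne_zero (single_nat_ne_zero hn)]
  have h4 : (∑ i : Fin 3, (((Pi.single (0 : Fin 3) ((n : ℕ) : ℤ) : Site 3) i : ℝ)) ^ 4) = (n : ℝ) ^ 4 := by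
    simp [Pi.single_apply]
  rw [h4, sum_sq_single]
  push_cast
  have : (n : ℝ) ≠ 0 := by exact_mod_cast (by omega : n ≠ 0)
  field_simp

/-- The diagonal embedding `n ↦ (n,n,n)`. -/
theorem diag_injective : Function.Injective (fun n : ℕ => (fun _ : Fin 3 => ((n : ℕ) : ℤ) : Site 3)) := by
  intro a b h
  have := congrFun h 0
  simpa using this

theorem diag_ne_zero {n : ℕ} (hn : 1 ≤ n) : (fun _ : Fin 3 => ((n : ℕ) : ℤ) : Site 3) ≠ 0 := by
  intro h
  have := congrFun h 0
  simp at this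
  omega

theorem sum_sq_diag (n : ℕ) : (∑ i : Fin 3, ((((fun _ : Fin 3 => ((n : ℕ) : ℤ)) : Site 3) i : ℝ)) ^ 2) = 3 * (n : ℝ) ^ 2 := by
  simp [Finset.sum_const, Finset.card_univ, Fintype.card_fin]

theorem sqrt_sum_sq_diag (n : ℕ) :
    Real.sqrt (∑ i : Fin 3, ((((fun _ : Fin 3 => ((n : ℕ) : ℤ)) : Site 3) i : ℝ)) ^ 2) = Real.sqrt 3 * n := by
  rw [sum_sq_diag, Real.sqrt_mul' _ (sq_nonneg _), Real.sqrt_sq (Nat.cast_nonneg n)]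

/-- On the diagonal: `G (n,n,n) = 1/(9n²)`. -/
theorem GQ_diag {n : ℕ} (hn : 1 ≤ n) : GQ (fun _ : Fin 3 => ((n : ℕ) : ℤ)) = 1 / (9 * (n : ℝ) ^ 2) := by
  rw [GQ_of_ne_zero (diag_ne_zero hn), sum_sq_diag]
  have h4 : (∑ i : Fin 3, ((((fun _ : Fin 3 => ((n : ℕ) : ℤ)) : Site 3) i : ℝ)) ^ 4) = 3 * (n : ℝ) ^ 4 := by
    simp [Finset.sum_const, Finset.card_univ, Fintype.card_fin]
  rw [h4]
  have : (n : ℝ) ≠ 0 := by exact_mod_cast (by omega : n ≠ 0)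
  field_simp
  ring

/-- A cofinite limit on `ℤ³` restricts to a limit along the diagonal `n ↦ (n,n,n)`. -/
theorem tendsto_diag_of_cofinite {F : Site 3 → ℝ} {l : Filter ℝ} (h : Tendsto F cofinite l) :
    Tendsto (fun n : ℕ => F (fun _ : Fin 3 => ((n : ℕ) : ℤ))) atTop l := by
  rw [← Nat.cofinite_eq_atTop]
  exact h.comp diag_injective.tendsto_cofinite

/-- W3 lies in the envelope: `‖x‖⁻²/9 ≤ G x ≤ ‖x‖⁻¹`. -/
theorem envelope_GQ : EnvelopeOf GQ := by
  refine ⟨1 / 9, 1, by norm_num, fun x hx => ?_⟩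
  rw [GQ_of_ne_zero hx]
  set S2 := ∑ i, ((x i : ℝ)) ^ 2 with hS2
  set S4 := ∑ i, ((x i : ℝ)) ^ 4 with hS4
  have hx1 : (1 : ℝ) ≤ ‖x‖ := one_le_norm_of_ne_zero hx
  have hS2x : ‖x‖ ^ 2 ≤ S2 := by
    have h := norm_le_sqrt_sum_sq x
    have h' : ‖x‖ ^ 2 ≤ Real.sqrt S2 ^ 2 := pow_le_pow_left₀ (norm_nonneg _) h 2
    rwa [Real.sq_sqrt (by positivity)] at h'
  have hS2x' : S2 ≤ 3 * ‖x‖ ^ 2 := by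
    have h : ∀ i, ((x i : ℝ)) ^ 2 ≤ ‖x‖ ^ 2 := fun i => by
      have h1 : |(x i : ℝ)| ≤ ‖x‖ := by rw [← Int.norm_eq_abs]; exact norm_le_pi_norm x i
      nlinarith [abs_nonneg ((x i : ℝ)), sq_abs ((x i : ℝ))]
    calc S2 ≤ ∑ _i : Fin 3, ‖x‖ ^ 2 := Finset.sum_le_sum fun i _ => h i
      _ = 3 * ‖x‖ ^ 2 := by simp
  have h42 : S4 ≤ S2 ^ 2 := by
    simp only [hS4, hS2, Fin.sum_univ_three]
    nlinarith [sq_nonneg ((x 0 : ℝ)), sq_nonneg ((x 1 : ℝ)), sq_nonneg ((x 2 : ℝ)),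
      mul_nonneg (sq_nonneg ((x 0 : ℝ))) (sq_nonneg ((x 1 : ℝ))),
      mul_nonneg (sq_nonneg ((x 0 : ℝ))) (sq_nonneg ((x 2 : ℝ))),
      mul_nonneg (sq_nonneg ((x 1 : ℝ))) (sq_nonneg ((x 2 : ℝ)))]
  have h24 : S2 ^ 2 ≤ 3 * S4 := by
    simp only [hS4, hS2, Fin.sum_univ_three]
    nlinarith [sq_nonneg (((x 0 : ℝ)) ^ 2 - ((x 1 : ℝ)) ^ 2), sq_nonneg (((x 0 : ℝ)) ^ 2 - ((x 2 : ℝ)) ^ 2),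
      sq_nonneg (((x 1 : ℝ)) ^ 2 - ((x 2 : ℝ)) ^ 2)]
  have hS2pos : 0 < S2 := by nlinarith
  constructor
  · rw [Real.rpow_neg (by linarith), Real.rpow_two]
    rw [div_eq_mul_inv, le_div_iff₀ (by positivity)]
    -- 1/9 * (‖x‖²)⁻¹ * S2³ ≤ S4
    have : 1 / 9 * (‖x‖ ^ 2)⁻¹ * S2 ^ 3 ≤ 1 / 9 * (‖x‖ ^ 2)⁻¹ * (S2 ^ 2 * (3 * ‖x‖ ^ 2)) := by
      gcongr
      nlinarith
    calc 1 / 9 * (‖x‖ ^ 2)⁻¹ * S2 ^ 3 ≤ 1 / 9 * (‖x‖ ^ 2)⁻¹ * (S2 ^ 2 * (3 * ‖x‖ ^ 2)) := this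
      _ = S2 ^ 2 / 3 := by field_simp; norm_num
      _ ≤ S4 := by linarith
  · rw [Real.rpow_neg_one, div_le_iff₀ (by positivity)]
    calc S4 ≤ S2 ^ 2 := h42
      _ = S2 ^ 2 * 1 := by ring
      _ ≤ S2 ^ 2 * (‖x‖⁻¹ * S2) := by
          gcongr
          rw [le_inv_mul_iff₀ (by linarith)]
          nlinarith
      _ = 1 * ‖x‖⁻¹ * S2 ^ 3 := by ring

/-- W3 satisfies T1 EXACTLY at `Δ = 1`: `G(2^j e₀)·(2^j)² = 1`. -/
theorem dyadicTowerLaw_GQ : DyadicTowerLawOf GQ := by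
  refine ⟨1, 1, one_pos, ?_⟩
  refine (tendsto_const_nhds (x := (1 : ℝ))).congr fun j => ?_
  rw [GQ_single Nat.one_le_two_pow, show (2 : ℝ) * 1 = 2 by norm_num, Real.rpow_two]
  push_cast
  have : (2 : ℝ) ^ j ≠ 0 := by positivity
  field_simp

/-- W3 satisfies the ray dilation law Sray EXACTLY at `Δ = 1` (constant sequences `1` from `n = 1` on). -/
theorem rayDilationLaw_GQ : RayDilationLawAtOf GQ 1 := by
  intro v hv k hk
  refine (tendsto_const_nhds (x := (1 : ℝ))).congr' ?_
  filter_upwards [eventually_ge_atTop 1] with n hn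
  have hkn : ((k * n : ℕ) : ℤ) ≠ 0 := by exact_mod_cast (Nat.mul_ne_zero (by omega) (by omega))
  have hn' : ((n : ℕ) : ℤ) ≠ 0 := by exact_mod_cast (by omega : n ≠ 0)
  rw [GQ_zsmul hv hkn, GQ_zsmul hv hn', show (2 : ℝ) * 1 = 2 by norm_num, Real.rpow_two]
  have hG : GQ v ≠ 0 := (GQ_pos v).ne'
  have hk0 : (k : ℝ) ≠ 0 := by exact_mod_cast (by omega : k ≠ 0)
  have hn0 : (n : ℝ) ≠ 0 := by exact_mod_cast (by omega : n ≠ 0)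
  push_cast
  field_simp

/-- In particular S2 at `Δ = 1` (the ray `v = e₀`). -/
theorem integerDilationLaw_GQ : IntegerDilationLawAtOf GQ 1 := by
  intro k hk
  have h := rayDilationLaw_GQ (Pi.single 0 ((1 : ℕ) : ℤ)) (single_nat_ne_zero le_rfl) k hk
  refine h.congr fun n => ?_
  have e : ∀ m : ℕ, ((((m : ℕ) : ℤ)) • (Pi.single (0 : Fin 3) ((1 : ℕ) : ℤ) : Site 3)) =
      Pi.single 0 ((m : ℕ) : ℤ) := fun m => by
    ext i
    simp [Pi.single_apply]
  rw [e, e]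

/-- The floor radius of the diagonal point, `⌊√3·n⌋`, over `n` tends to `√3`. -/
theorem tendsto_floor_sqrt_three_mul_div :
    Tendsto (fun n : ℕ => ((⌊Real.sqrt 3 * (n : ℝ)⌋₊ : ℕ) : ℝ) / (n : ℝ)) atTop (𝓝 (Real.sqrt 3)) := by
  have hs : (0 : ℝ) < Real.sqrt 3 := by positivity
  have h1 : Tendsto (fun n : ℕ => Real.sqrt 3 * (n : ℝ)) atTop atTop :=
    tendsto_natCast_atTop_atTop.const_mul_atTop hs
  have h2 := (tendsto_nat_floor_div_atTop (R := ℝ)).comp h1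
  have h3 := h2.mul_const (Real.sqrt 3)
  rw [one_mul] at h3
  refine h3.congr' ?_
  filter_upwards [eventually_ge_atTop 1] with n hn
  have hn0 : (n : ℝ) ≠ 0 := by exact_mod_cast (by omega : n ≠ 0)
  simp only [Function.comp_apply]
  field_simp

/-- **W3 violates ratio isotropy S3**: along the diagonal the ratio tends to `1/3`. -/
theorem not_ratioIsotropy_GQ : ¬ RatioIsotropyOf GQ := by
  intro h
  have hd := tendsto_diag_of_cofinite h
  -- the diagonal ratio is `⌊√3 n⌋² / (9 n²)` for `n ≥ 1`
  have hlim : Tendsto (fun n : ℕ => GQ (fun _ : Fin 3 => ((n : ℕ) : ℤ)) /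
      GQ (Pi.single 0 ((⌊Real.sqrt (∑ i : Fin 3, ((((fun _ : Fin 3 => ((n : ℕ) : ℤ)) : Site 3) i : ℝ)) ^ 2)⌋₊ : ℕ) : ℤ)))
      atTop (𝓝 (Real.sqrt 3 ^ 2 / 9)) := by
    have h9 := (tendsto_floor_sqrt_three_mul_div.pow 2).div_const 9
    refine h9.congr' ?_
    filter_upwards [eventually_ge_atTop 1] with n hn
    have hm : 1 ≤ ⌊Real.sqrt 3 * (n : ℝ)⌋₊ := by
      refine Nat.le_floor ?_
      have h1 : (1 : ℝ) ≤ Real.sqrt 3 := by rw [Real.le_sqrt (by norm_num) (by norm_num)]; norm_num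
      have h2 : (1 : ℝ) ≤ n := by exact_mod_cast hn
      push_cast
      nlinarith
    rw [sqrt_sum_sq_diag, GQ_diag hn, GQ_single hm]
    have hn0 : (n : ℝ) ≠ 0 := by exact_mod_cast (by omega : n ≠ 0)
    have hm0 : ((⌊Real.sqrt 3 * (n : ℝ)⌋₊ : ℕ) : ℝ) ≠ 0 := by exact_mod_cast (by omega : ⌊Real.sqrt 3 * (n : ℝ)⌋₊ ≠ 0)
    field_simp
  have := tendsto_nhds_unique hd hlim
  rw [Real.sq_sqrt (by norm_num)] at this
  norm_num at this

/-- **W3 violates the crux**: doubling along the axis forces `Δ = 1`; axis and diagonal then give the two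
different limits `1` and `1/3`. -/
theorem not_powerLaw_GQ : ¬ PowerLawOf GQ := by
  intro hP
  obtain ⟨Δ, c, hc, hcof⟩ := hP
  obtain ⟨Δ', c', hc', h⟩ := axisPowerLaw_of_powerLaw ⟨Δ, c, hc, hcof⟩
  -- work directly with the cofinite statement restricted to axis and diagonal at the SAME (Δ, c)
  have hax : Tendsto (fun n : ℕ => GQ (Pi.single 0 ((n : ℕ) : ℤ)) * (n : ℝ) ^ (2 * Δ)) atTop (𝓝 c) := by
    refine (tendsto_axis_of_cofinite hcof).congr fun n => ?_
    simp only [sqrt_sum_sq_single_nat]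
  -- doubling along the axis
  have hmono : StrictMono fun n : ℕ => 2 * n := fun a b hab => by dsimp only; omega
  have hd := hax.comp hmono.tendsto_atTop
  have e : ∀ n : ℕ, 1 ≤ n → GQ (Pi.single 0 ((2 * n : ℕ) : ℤ)) * ((2 * n : ℕ) : ℝ) ^ (2 * Δ) =
      (2 : ℝ) ^ (2 * Δ) / 4 * (GQ (Pi.single 0 ((n : ℕ) : ℤ)) * (n : ℝ) ^ (2 * Δ)) := by
    intro n hn
    rw [GQ_single hn, GQ_single (by omega)]
    push_cast
    rw [Real.mul_rpow (by norm_num) (Nat.cast_nonneg n)]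
    have hn0 : (n : ℝ) ≠ 0 := by exact_mod_cast (by omega : n ≠ 0)
    field_simp
    ring
  have hd' : Tendsto (fun n : ℕ => GQ (Pi.single 0 ((2 * n : ℕ) : ℤ)) * ((2 * n : ℕ) : ℝ) ^ (2 * Δ))
      atTop (𝓝 ((2 : ℝ) ^ (2 * Δ) / 4 * c)) :=
    (hax.const_mul _).congr' ((eventually_ge_atTop 1).mono fun n hn => (e n hn).symm)
  have key : (2 : ℝ) ^ (2 * Δ) / 4 * c = c := tendsto_nhds_unique hd' hd
  have hΔ : 2 * Δ = 2 := by
    have h1 : (2 : ℝ) ^ (2 * Δ) / 4 = 1 := mul_right_cancel₀ hc.ne' (key.trans (one_mul c).symm)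
    have h22 : (2 : ℝ) ^ (2 * Δ) = (2 : ℝ) ^ (2 : ℝ) := by norm_num; linarith
    have := congrArg (Real.logb 2) h22
    rwa [Real.logb_rpow two_pos (by norm_num), Real.logb_rpow two_pos (by norm_num)] at this
  -- axis: value 1 from n = 1 on
  have hc1 : c = 1 := by
    refine tendsto_nhds_unique hax (tendsto_const_nhds.congr' ?_)
    filter_upwards [eventually_ge_atTop 1] with n hn
    rw [GQ_single hn, hΔ, Real.rpow_two]
    have hn0 : (n : ℝ) ≠ 0 := by exact_mod_cast (by omega : n ≠ 0)
    field_simp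
  -- diagonal: value 1/3 from n = 1 on
  have hdiag : Tendsto (fun n : ℕ => GQ (fun _ : Fin 3 => ((n : ℕ) : ℤ)) *
      Real.sqrt (∑ i : Fin 3, ((((fun _ : Fin 3 => ((n : ℕ) : ℤ)) : Site 3) i : ℝ)) ^ 2) ^ (2 * Δ))
      atTop (𝓝 c) := tendsto_diag_of_cofinite hcof
  have hc3 : c = 1 / 3 := by
    refine tendsto_nhds_unique hdiag (tendsto_const_nhds.congr' ?_)
    filter_upwards [eventually_ge_atTop 1] with n hn
    rw [GQ_diag hn, sqrt_sum_sq_diag, hΔ, Real.rpow_two, mul_pow, Real.sq_sqrt (by norm_num)]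
    have hn0 : (n : ℝ) ≠ 0 := by exact_mod_cast (by omega : n ≠ 0)
    field_simp
    ring
  rw [hc1] at hc3
  norm_num at hc3

/-! ## §5 The separations, assembled (what a proof of each open stub must use beyond the others)

Hyperoctahedral symmetry is phrased as invariance under all signed coordinate permutations. The radial-by-floor
witnesses W1, W2 are functions of `Σ xᵢ²` and hence symmetric too. -/

theorem sum_sq_symm (σ : Equiv.Perm (Fin 3)) (ε : Fin 3 → ℤ) (hε : ∀ i, ε i = 1 ∨ ε i = -1) (x : Site 3) :
    (∑ i, (((ε i * x (σ i) : ℤ) : ℝ)) ^ 2) = ∑ i, ((x i : ℝ)) ^ 2 := by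
  have : ∀ i, (((ε i * x (σ i) : ℤ) : ℝ)) ^ 2 = ((x (σ i) : ℝ)) ^ 2 := fun i => by
    rcases hε i with h | h <;> simp [h]
  simp_rw [this]
  exact Equiv.sum_comp σ (fun j => ((x j : ℝ)) ^ 2)

theorem GLP_symm (σ : Equiv.Perm (Fin 3)) (ε : Fin 3 → ℤ) (hε : ∀ i, ε i = 1 ∨ ε i = -1) (x : Site 3) :
    GLP (fun i => ε i * x (σ i)) = GLP x := by
  simp only [GLP, sum_sq_symm σ ε hε x]

theorem GDR_symm (σ : Equiv.Perm (Fin 3)) (ε : Fin 3 → ℤ) (hε : ∀ i, ε i = 1 ∨ ε i = -1) (x : Site 3) :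
    GDR (fun i => ε i * x (σ i)) = GDR x := by
  simp only [GDR, sum_sq_symm σ ε hε x]

/-- **S2 is load-bearing / not implied (W2).** Positivity, cubic symmetry, the envelope, the dyadic tower law
T1, ratio isotropy S3 and the angular profile statement A (with `Ψ ≡ 1`) together do NOT imply the integer
dilation law S2 at any exponent. -/
theorem integerDilationLaw_not_of_tower_isotropy_envelope :
    ¬ ∀ G : Site 3 → ℝ, (∀ x, 0 < G x) →
      (∀ (σ : Equiv.Perm (Fin 3)) (ε : Fin 3 → ℤ), (∀ i, ε i = 1 ∨ ε i = -1) → ∀ x, G (fun i => ε i * x (σ i)) = G x) →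
      EnvelopeOf G → DyadicTowerLawOf G → RatioIsotropyOf G → AngularProfileAtOf G (fun _ => 1) →
      ∃ Δ : ℝ, IntegerDilationLawAtOf G Δ := by
  intro h
  obtain ⟨Δ, hΔ⟩ := h GLP GLP_pos GLP_symm envelope_GLP dyadicTowerLaw_GLP ratioIsotropy_GLP angularProfile_GLP
  exact not_integerDilationLaw_GLP Δ hΔ

/-- **The crux is not implied by T1 ∧ S3 ∧ A ∧ envelope ∧ symmetry (W2).** -/
theorem powerLaw_not_of_tower_isotropy_envelope :
    ¬ ∀ G : Site 3 → ℝ, (∀ x, 0 < G x) →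
      (∀ (σ : Equiv.Perm (Fin 3)) (ε : Fin 3 → ℤ), (∀ i, ε i = 1 ∨ ε i = -1) → ∀ x, G (fun i => ε i * x (σ i)) = G x) →
      EnvelopeOf G → DyadicTowerLawOf G → RatioIsotropyOf G → AngularProfileAtOf G (fun _ => 1) →
      PowerLawOf G := fun h =>
  not_powerLaw_GLP (h GLP GLP_pos GLP_symm envelope_GLP dyadicTowerLaw_GLP ratioIsotropy_GLP angularProfile_GLP)

/-- **T1 is load-bearing / not implied (W1).** Positivity, cubic symmetry, the envelope, the integer dilation
law S2 (at `Δ = 1/2`), ratio isotropy S3 and A (`Ψ ≡ 1`) together do NOT imply the dyadic tower law T1. -/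
theorem dyadicTowerLaw_not_of_dilation_isotropy_envelope :
    ¬ ∀ G : Site 3 → ℝ, (∀ x, 0 < G x) →
      (∀ (σ : Equiv.Perm (Fin 3)) (ε : Fin 3 → ℤ), (∀ i, ε i = 1 ∨ ε i = -1) → ∀ x, G (fun i => ε i * x (σ i)) = G x) →
      EnvelopeOf G → (∃ Δ : ℝ, IntegerDilationLawAtOf G Δ) → RatioIsotropyOf G → AngularProfileAtOf G (fun _ => 1) →
      DyadicTowerLawOf G := fun h =>
  not_dyadicTowerLaw_GDR (h GDR GDR_pos GDR_symm envelope_GDR ⟨1 / 2, integerDilationLaw_GDR⟩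
    ratioIsotropy_GDR angularProfile_GDR)

/-- **The crux is not implied by S2 ∧ S3 ∧ A ∧ envelope ∧ symmetry (W1).** -/
theorem powerLaw_not_of_dilation_isotropy_envelope :
    ¬ ∀ G : Site 3 → ℝ, (∀ x, 0 < G x) →
      (∀ (σ : Equiv.Perm (Fin 3)) (ε : Fin 3 → ℤ), (∀ i, ε i = 1 ∨ ε i = -1) → ∀ x, G (fun i => ε i * x (σ i)) = G x) →
      EnvelopeOf G → (∃ Δ : ℝ, IntegerDilationLawAtOf G Δ) → RatioIsotropyOf G → AngularProfileAtOf G (fun _ => 1) →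
      PowerLawOf G := fun h =>
  not_powerLaw_GDR (h GDR GDR_pos GDR_symm envelope_GDR ⟨1 / 2, integerDilationLaw_GDR⟩
    ratioIsotropy_GDR angularProfile_GDR)

/-- **Reflection positivity is load-bearing in R / Rray (W3).** Positivity, cubic symmetry, the envelope, T1
and the ray dilation law Sray along EVERY lattice ray (at `Δ = 1`) together do NOT imply ratio isotropy S3:
the model-blind form of `stub_rayRigidityTransfer` / `stub_rigidityTransfer` is false. -/
theorem ratioIsotropy_not_of_tower_rayDilation_envelope :
    ¬ ∀ G : Site 3 → ℝ, (∀ x, 0 < G x) →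
      (∀ (σ : Equiv.Perm (Fin 3)) (ε : Fin 3 → ℤ), (∀ i, ε i = 1 ∨ ε i = -1) → ∀ x, G (fun i => ε i * x (σ i)) = G x) →
      EnvelopeOf G → DyadicTowerLawOf G → (∃ Δ : ℝ, RayDilationLawAtOf G Δ) → RatioIsotropyOf G := fun h =>
  not_ratioIsotropy_GQ (h GQ GQ_pos GQ_symm envelope_GQ dyadicTowerLaw_GQ ⟨1, rayDilationLaw_GQ⟩)

/-- **The crux is not implied by T1 ∧ Sray ∧ envelope ∧ symmetry (W3).** -/
theorem powerLaw_not_of_tower_rayDilation_envelope :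
    ¬ ∀ G : Site 3 → ℝ, (∀ x, 0 < G x) →
      (∀ (σ : Equiv.Perm (Fin 3)) (ε : Fin 3 → ℤ), (∀ i, ε i = 1 ∨ ε i = -1) → ∀ x, G (fun i => ε i * x (σ i)) = G x) →
      EnvelopeOf G → DyadicTowerLawOf G → (∃ Δ : ℝ, RayDilationLawAtOf G Δ) → PowerLawOf G := fun h =>
  not_powerLaw_GQ (h GQ GQ_pos GQ_symm envelope_GQ dyadicTowerLaw_GQ ⟨1, rayDilationLaw_GQ⟩)

/-! ## §6 F2′ — the axis toolkit (incl. reflection positivity, complete monotonicity) does not see S2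

Restated from the landed `Negative/LaplaceGaugeSeparation.lean` (witness W4 = reflection-positive log₂-periodic
Laplace gauge). The six hypotheses are exactly what the tree knows about the axis sequence `n ↦ ⟨σ₀σ_{ne₀}⟩_{β_c}`
(positivity; `criticalTwoPoint_axis_succ_le`; `criticalTwoPoint_axis_sq_le`; half-line RP from
`CriticalCorrNineMirrorRP_holds`; `criticalTwoPoint_bounds_holds`) plus T1; the refuted conclusion is S2 verbatim
with `criticalTwoPoint 3 (Pi.single 0 ·)` replaced by `g`. -/

/-- **F2′.** {positivity, antitone, log-convex, half-line reflection positive, envelope, T1} ⊬ S2 for axis sequences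
`g : ℕ → ℝ`. -/
theorem integerDilationLaw_not_of_axisToolkit :
    ¬ ∀ g : ℕ → ℝ, (∀ n, 0 < g n) → (∀ n, g (n + 1) ≤ g n) → (∀ n, 1 ≤ n → g n ^ 2 ≤ g (n - 1) * g (n + 1)) →
      (∀ (m : ℕ) (p : Fin m → ℕ) (c : Fin m → ℝ), (∀ a, 1 ≤ p a) → 0 ≤ ∑ a, ∑ b, c a * c b * g (p a + p b)) →
      (∃ c C : ℝ, 0 < c ∧ ∀ n : ℕ, 1 ≤ n → c / (n : ℝ) ^ 2 ≤ g n ∧ g n ≤ C / (n : ℝ)) →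
      (∃ Δ c : ℝ, 0 < c ∧ Tendsto (fun j : ℕ => g (2 ^ j) * ((2 ^ j : ℕ) : ℝ) ^ (2 * Δ)) atTop (𝓝 c)) →
      ∃ Δ : ℝ, ∀ k : ℕ, 1 ≤ k → Tendsto (fun n : ℕ => g (k * n) * (k : ℝ) ^ (2 * Δ) / g n) atTop (𝓝 1) :=
  Theorems.IsingEuclidUpgradeR2RotInvPowerLaw.Negative.lap_integerDilationLaw_not_of_axisToolkit

/-- At `g := (criticalTwoPoint 3 ∘ Pi.single 0 ∘ Nat.cast)` the refuted conclusion of F2′ IS the registered stub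
`stub_integerDilationLaw` (and T1 IS `stub_dyadicTowerLaw`). -/
example : (∃ Δ : ℝ, IntegerDilationLawAtOf (criticalTwoPoint 3) Δ) ↔
    ∃ Δ : ℝ, ∀ k : ℕ, 1 ≤ k → Tendsto (fun n : ℕ => criticalTwoPoint 3 (Pi.single 0 ((k * n : ℕ) : ℤ)) *
      (k : ℝ) ^ (2 * Δ) / criticalTwoPoint 3 (Pi.single 0 ((n : ℕ) : ℤ))) atTop (𝓝 1) := Iff.rfl

end Summit.CriticalPhenomena.Ising3DConformalLimit.Cruxes.IsingEuclidUpgradeR2RotInvPowerLaw.Disproof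

end
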